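/-
Copyright (c) 2026 The decomp-a2c cell. All rights reserved.
Released under Apache 2.0 license as described in the file LICENSE.
-/
import Summits.AtomisticToContinuum.Crystallization.Theorems.ChartedZeroExcessLayeredLatticeLiouvilleWM

/-!
# ChartedZeroExcessLayeredLatticeLiouville — part WN «ModalAssembly»: the modulus brick (4a) `ModalLipschitzAt` REDUCED to the profile comparison on
  the central column (decomp-a2c-lens-2, g58; helper of stmt-AtomisticToContinuum-26636, leaf (LD′) `ModalLipschitzZ`; brick (4a), memo NODE-g58d §2)

The mode attached to a harmonic field `φ` at the centre `x₀` is `M = modeField (slopeAt φ x₀) cf`: in-plane slope `slopeAt φ x₀ j = D_{e_j}φ(x₀)`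
and a layer profile `cf : ℤ → E3`.  A unit bond `X ~ Y` of the half ball (sup metric, `Y − X ∈ {−1,0,1}³`) is split at the corner `(Y.1, X.2)`
(`unitBond_split`): the IN-PLANE LEG is `D_E(φ − M)(X) = [D_Eφ(X) − D_Eφ(x₀)] + [D_Eφ(x₀) − Σ_j E_j·slopeAt_j]` (slope drift, part WM
`inPlane_bond_halfBall`; corner defect, an in-layer walk of radius one, `inPlane_leg`), the VERTICAL LEG is `±D₃(φ − M)(Z)`, `Z ∈ {(Y.1,X.2), Y}`,
`= [D₃φ(Z) − D₃φ(x₀.1, Z.2)] + [D₃φ(x₀.1, Z.2) − (cf(Z.2+1) − cf Z.2)]` (in-layer transport, WM `vertical_bond_inPlane_halfBall`; PROFILE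
COMPARISON on the central column, `vertical_leg`).  Hence:

* `ProfileComparisonAt C ϱ n₁ a b w` (PC, the typed OPEN LEAF below (4a)): for `φ` harmonic on `idxBall x₀ n`, `n ≥ n₁`, SOME profile `cf`
  makes `modeField (slopeAt φ x₀) cf` a `ϱ`-truncated mode with `n²·N·‖D₃φ(x₀.1, β) − (cf(β+1) − cf β)‖² ≤ C·(|β − x₀.2| + 1)²·E` for
  `|β − x₀.2| ≤ n/2`;
* ★★ `modalLipschitzAt_of_profileComparison : ProfileComparisonAt C₀ ϱ n₀ a b w → ModalLipschitzAt (16·(4320·ipConst + 3456·gradConst + C₀)) ϱ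
  (max n₀ (512(ϱ/c+2))) a b w` under the standing hypotheses (tail smallness `hT`, Caccioppoli `hP`).
The proof plan for (PC) itself (part VV `mode_extraction` with the flux of `φ` at the centre, part WB's window inverse, a `ϱ`-free bootstrap)
is memo NODE-g58d §3.
-/

namespace Summit.AtomisticToContinuum.Crystallization.Theorems.ChartedZeroExcessLayeredLatticeLiouville

open Summit.AtomisticToContinuum.Crystallization.Theorems.ChartedPlanarOrderRigidityDoor (E3)
open Finset
open scoped InnerProductSpace RealInnerProductSpace BigOperators

noncomputable section ModalAssembly

variable {c : ℝ} {a b : E3} {w : ℤ → E3}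

/-! ### WN.1  The mode attached to a centre and the profile-comparison statement (PC) -/

/-- the in-plane slope of `φ` at `x₀` as a `Fin 2`-family: `slopeAt φ x₀ j = D_{e_j} φ(x₀)`. [this file, g58] -/
def slopeAt (φ : Cell 2 → ℤ → E3) (x₀ : Cell 2 × ℤ) : Fin 2 → E3 := fun j => latDiff (Pi.single j 1, 0) φ x₀.1 x₀.2

/-- (PC) PROFILE COMPARISON ON THE CENTRAL COLUMN with constant `C` beyond scale `n₁`: for `φ` harmonic on `idxBall x₀ n`, `n ≥ n₁`, some
layer profile `cf` makes `modeField (slopeAt φ x₀) cf` a `ϱ`-truncated mode AND matches the vertical increments of `φ` along the central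
column: `n²·#ball·‖D₃φ(x₀.1, β) − (cf(β+1) − cf β)‖² ≤ C·(|β − x₀.2| + 1)²·E(φ; idxBall x₀ n)` for `|β − x₀.2| ≤ n/2`.  The ONE remaining
statement of brick (4a) (memo NODE-g58d §2–3; reduction of record, critic row 1007 (i)); WEAKER than (LD′) modulo the slope normalisation
`g = Dφ(x₀)` (row 1007 (i)).  OPEN LEAF below (4a): typed here so that it is pinned; its `_holds` is owed (parts WO–WS of the plan). [this file, g58] -/
def ProfileComparisonAt (C ϱ n₁ : ℝ) (a b : E3) (w : ℤ → E3) : Prop :=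
  ∀ (φ : Cell 2 → ℤ → E3) (x₀ : Cell 2 × ℤ) (n : ℝ), n₁ ≤ n → IsTruncHarmonicZ ϱ a b w φ (idxBall x₀ n) →
    ∃ cf : ℤ → E3, IsTruncMode ϱ a b w (modeField (slopeAt φ x₀) cf) ∧
      ∀ β : ℤ, |((β - x₀.2 : ℤ) : ℝ)| ≤ n / 2 →
        n ^ 2 * ((idxBall x₀ n).ncard : ℝ) * ‖latDiff idxAxis₃ φ x₀.1 β - (cf (β + 1) - cf β)‖ ^ 2 ≤
          C * (|((β - x₀.2 : ℤ) : ℝ)| + 1) ^ 2 * idxEnergy φ (idxBall x₀ n)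

/-- in-plane increments of a mode field are the constant slope. [formal bookkeeping] -/
theorem latDiff_modeField_inPlane (g : Fin 2 → E3) (cf : ℤ → E3) {E : Cell 2 × ℤ} (hE : E.2 = 0) (Z : Cell 2 × ℤ) :
    latDiff E (modeField g cf) Z.1 Z.2 = ∑ j, ((E.1 j : ℤ) : ℝ) • g j := by
  rw [latDiff_apply]
  simp only [modeField, Prod.fst_add, Prod.snd_add, hE, add_zero, Pi.add_apply, Int.cast_add, add_smul, sum_add_distrib]
  abel

/-- vertical increments of a mode field are the profile increments. [formal bookkeeping] -/
theorem latDiff_modeField_axis₃ (g : Fin 2 → E3) (cf : ℤ → E3) (Z : Cell 2 × ℤ) :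
    latDiff idxAxis₃ (modeField g cf) Z.1 Z.2 = cf (Z.2 + 1) - cf Z.2 := by
  rw [latDiff_axis₃_apply]
  simp only [modeField, add_sub_add_left_eq_sub]

/-- the slope family reproduces the first axis increment at the centre. [formal bookkeeping] -/
theorem sum_idxAxis₁_smul_slopeAt (φ : Cell 2 → ℤ → E3) (x₀ : Cell 2 × ℤ) :
    ∑ j, ((idxAxis₁.1 j : ℤ) : ℝ) • slopeAt φ x₀ j = latDiff idxAxis₁ φ x₀.1 x₀.2 := by
  simp [slopeAt, idxAxis₁, Pi.single_apply]

/-- the slope family reproduces the second axis increment at the centre. [formal bookkeeping] -/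
theorem sum_idxAxis₂_smul_slopeAt (φ : Cell 2 → ℤ → E3) (x₀ : Cell 2 × ℤ) :
    ∑ j, ((idxAxis₂.1 j : ℤ) : ℝ) • slopeAt φ x₀ j = latDiff idxAxis₂ φ x₀.1 x₀.2 := by
  simp [slopeAt, idxAxis₂, Pi.single_apply]

/-! ### WN.2  Lattice geometry of a unit bond -/

/-- the corner site of a bond is no farther from the centre than its endpoints. [formal bookkeeping] -/
theorem dist_corner_le (X Y x₀ : Cell 2 × ℤ) : dist (Y.1, X.2) x₀ ≤ max (dist X x₀) (dist Y x₀) := by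
  have h0 : ((Y.1 - x₀.1) 0).natAbs ≤ max (idxNorm (X - x₀)) (idxNorm (Y - x₀)) :=
    (natAbs_fst_le_idxNorm (Y - x₀) 0).trans (le_max_right _ _)
  have h1 : ((Y.1 - x₀.1) 1).natAbs ≤ max (idxNorm (X - x₀)) (idxNorm (Y - x₀)) :=
    (natAbs_fst_le_idxNorm (Y - x₀) 1).trans (le_max_right _ _)
  have h2 : (X.2 - x₀.2).natAbs ≤ max (idxNorm (X - x₀)) (idxNorm (Y - x₀)) :=
    (natAbs_snd_le_idxNorm (X - x₀)).trans (le_max_left _ _)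
  have h := idxNorm_mk_le (p := Y.1 - x₀.1) (q := X.2 - x₀.2) h0 h1 h2
  have e : (Y.1, X.2) - x₀ = (Y.1 - x₀.1, X.2 - x₀.2) := rfl
  rw [dist_comm (Y.1, X.2), dist_eq_idxNorm, dist_comm X, dist_eq_idxNorm, dist_comm Y, dist_eq_idxNorm, ← Nat.cast_max, e]
  exact_mod_cast h

/-- BOND SPLIT: a unit bond `X ~ Y` of `idxBall x₀ r` passes through the corner `(Y.1, X.2)` of the same ball, at distance `≤ dist X x₀ + 1`; the
in-plane leg is the unit step `(Y.1 − X.1, 0)`, and the vertical leg is (up to sign) ONE vertical increment at a site `Z` of the ball. [this file, g58] -/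
theorem unitBond_split (f : Cell 2 → ℤ → E3) {x₀ X Y : Cell 2 × ℤ} {r : ℝ} (hX : X ∈ idxBall x₀ r) (hY : Y ∈ idxBall x₀ r) (hXY : dist X Y ≤ 1) :
    (Y.1, X.2) ∈ idxBall x₀ r ∧ dist (Y.1, X.2) x₀ ≤ dist X x₀ + 1 ∧ (idxNorm ((Y.1 - X.1, 0) : Cell 2 × ℤ) : ℝ) ≤ 1 ∧
      X + (Y.1 - X.1, 0) = (Y.1, X.2) ∧
      ∃ Z ∈ idxBall x₀ r, dist Z x₀ ≤ dist X x₀ + 1 ∧ ‖f Y.1 Y.2 - f Y.1 X.2‖ ≤ ‖latDiff idxAxis₃ f Z.1 Z.2‖ := by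
  have dX : dist X x₀ ≤ r := hX
  have dY : dist Y x₀ ≤ r := hY
  have dY' : dist Y x₀ ≤ dist X x₀ + 1 := by linarith [dist_triangle Y X x₀, dist_comm X Y]
  have hV : (idxNorm (Y - X) : ℝ) ≤ 1 := by rwa [← dist_eq_idxNorm]
  have hV' : idxNorm (Y - X) ≤ 1 := by exact_mod_cast hV
  have hcor := dist_corner_le X Y x₀
  have hc1 : dist (Y.1, X.2) x₀ ≤ r := hcor.trans (max_le dX dY)
  have hc2 : dist (Y.1, X.2) x₀ ≤ dist X x₀ + 1 := hcor.trans (max_le (by linarith) dY')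
  have h2 : (Y.2 - X.2).natAbs ≤ 1 := (natAbs_snd_le_idxNorm (Y - X)).trans hV'
  have h0 : ((Y.1 - X.1) 0).natAbs ≤ 1 := (natAbs_fst_le_idxNorm (Y - X) 0).trans hV'
  have h1 : ((Y.1 - X.1) 1).natAbs ≤ 1 := (natAbs_fst_le_idxNorm (Y - X) 1).trans hV'
  refine ⟨hc1, hc2, ?_, Prod.ext (by simp) (by simp), ?_⟩
  · exact_mod_cast idxNorm_mk_le (p := Y.1 - X.1) (q := 0) (r := 1) h0 h1 (by simp)
  · rcases (show Y.2 = X.2 + 1 ∨ Y.2 = X.2 ∨ Y.2 + 1 = X.2 by omega) with h | h | h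
    · refine ⟨(Y.1, X.2), hc1, hc2, le_of_eq ?_⟩
      simp only [latDiff_axis₃_apply, h]
    · refine ⟨(Y.1, X.2), hc1, hc2, ?_⟩
      rw [h, sub_self, norm_zero]
      exact norm_nonneg _
    · refine ⟨Y, hY, dY', le_of_eq ?_⟩
      rw [latDiff_axis₃_apply, h, norm_sub_rev]

/-! ### WN.3  The two legs -/

/-- IN-PLANE LEG: `D_E(φ − M)(X)` = slope drift at `X` + corner defect at `x₀`, with `n²N‖·‖² ≤ 864·ipConst·dist(X,x₀)²·E` and `≤ 3456·ipConst·E`.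
[this file, g58] -/
theorem inPlane_leg (hc : 0 < c) (hL : IsLayeredCrystal c a b w) {κ₀ ε ϱ : ℝ} (hκ₀ : 0 < κ₀) (hϱ : 0 ≤ ϱ) (hε : ε < 2 * κ₀)
    (hK : CoerciveZ (layeredKernel a b w) κ₀)
    (hT : ∀ φ : Cell 2 → ℤ → E3, HasFiniteSupport φ → Summable (tailFam ϱ a b w φ) ∧ ∑' x, tailFam ϱ a b w φ x ≤ ε * nnFormZ φ)
    (hP : ∀ E₀ : Cell 2 × ℤ, E₀.2 = 0 → (idxNorm E₀ : ℝ) ≤ 1 → ∀ (y₀ : Cell 2 × ℤ) (r' n' : ℝ), r' < n' → ∀ χ : Cell 2 → ℤ → E3,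
      IsTruncHarmonicZ ϱ a b w χ (idxBall y₀ (n' + 1)) →
        κ₀ * idxEnergy (latDiff E₀ χ) (idxBall y₀ r') ≤ 54 * kernelConst c * ((n' - r')⁻¹) ^ 2 * idxEnergy χ (idxBall y₀ (n' + ϱ / c + 1)))
    (x₀ : Cell 2 × ℤ) {n : ℝ} (hn : 512 * (ϱ / c + 2) ≤ n) {φ : Cell 2 → ℤ → E3} (hφ : IsTruncHarmonicZ ϱ a b w φ (idxBall x₀ n))
    (cf : ℤ → E3) {E : Cell 2 × ℤ} (hE : E.2 = 0) (hE1 : (idxNorm E : ℝ) ≤ 1) {X : Cell 2 × ℤ} (hX : X ∈ idxBall x₀ (n / 2)) :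
    ∃ u v : E3, latDiff E (φ - modeField (slopeAt φ x₀) cf) X.1 X.2 = u + v ∧
      n ^ 2 * ((idxBall x₀ n).ncard : ℝ) * ‖u‖ ^ 2 ≤ 864 * ipConst c κ₀ ε * dist X x₀ ^ 2 * idxEnergy φ (idxBall x₀ n) ∧
      n ^ 2 * ((idxBall x₀ n).ncard : ℝ) * ‖v‖ ^ 2 ≤ 3456 * ipConst c κ₀ ε * idxEnergy φ (idxBall x₀ n) := by
  have hϱc : 0 ≤ ϱ / c := div_nonneg hϱ hc.le
  have hn0 : 0 < n := by linarith
  have hN := ncard_idxBall_pos x₀ hn0.le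
  have hip := ipConst_nonneg hc hκ₀ ε
  have hE0 := idxEnergy_nonneg φ (idxBall x₀ n)
  set f := φ - modeField (slopeAt φ x₀) cf with hfdef
  have key : ∀ E' : Cell 2 × ℤ, E'.2 = 0 → ∀ Z : Cell 2 × ℤ,
      latDiff E' f Z.1 Z.2 = latDiff E' φ Z.1 Z.2 - ∑ j, ((E'.1 j : ℤ) : ℝ) • slopeAt φ x₀ j := fun E' hE' Z => by
    simp only [hfdef, latDiff_sub, Pi.sub_apply, latDiff_modeField_inPlane _ _ hE']
  refine ⟨latDiff E φ X.1 X.2 - latDiff E φ x₀.1 x₀.2, latDiff E φ x₀.1 x₀.2 - ∑ j, ((E.1 j : ℤ) : ℝ) • slopeAt φ x₀ j,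
    by rw [key E hE]; abel, inPlane_bond_halfBall hc hL hκ₀ hϱ hε hK hT hP x₀ hn hφ hE hE1 hX, ?_⟩
  set P : ℝ := n ^ 2 * ((idxBall x₀ n).ncard : ℝ) with hPdef
  have hP0 : 0 < P := by positivity
  set A : ℝ := 864 * ipConst c κ₀ ε * idxEnergy φ (idxBall x₀ n) with hAdef
  have hA0 : 0 ≤ A := by positivity
  set δ : ℝ := Real.sqrt (A / P) with hδdef
  have hδ0 : 0 ≤ δ := Real.sqrt_nonneg _
  have memB : ∀ Z ∈ idxBallF x₀ 1, Z ∈ idxBall x₀ (n / 2) := fun Z hZ => by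
    rw [← mem_coe, coe_idxBallF] at hZ
    exact idxBall_mono x₀ (by linarith) hZ
  have step : ∀ E' : Cell 2 × ℤ, E'.2 = 0 → (idxNorm E' : ℝ) ≤ 1 → ∑ j, ((E'.1 j : ℤ) : ℝ) • slopeAt φ x₀ j = latDiff E' φ x₀.1 x₀.2 →
      ∀ Z ∈ idxBallF x₀ 1, ‖latDiff E' f Z.1 Z.2‖ ≤ δ := fun E' hE' hE'1 hsum Z hZ => by
    rw [key E' hE', hsum]
    apply norm_le_sqrt_of_sq hP0
    have h := inPlane_bond_halfBall hc hL hκ₀ hϱ hε hK hT hP x₀ hn hφ hE' hE'1 (memB Z hZ)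
    have hd : dist Z x₀ ^ 2 ≤ 1 := by
      have h1 := mem_idxBallF.mp hZ
      nlinarith [dist_nonneg (x := Z) (y := x₀)]
    calc P * ‖latDiff E' φ Z.1 Z.2 - latDiff E' φ x₀.1 x₀.2‖ ^ 2 ≤ 864 * ipConst c κ₀ ε * dist Z x₀ ^ 2 * idxEnergy φ (idxBall x₀ n) := h
      _ ≤ 864 * ipConst c κ₀ ε * 1 * idxEnergy φ (idxBall x₀ n) :=
          mul_le_mul_of_nonneg_right (mul_le_mul_of_nonneg_left hd (by positivity)) hE0
      _ = A := by rw [hAdef, mul_one]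
  have h₁ : ∀ Z ∈ idxBallF x₀ 1, Z + idxAxis₁ ∈ idxBallF x₀ 1 → ‖latDiff idxAxis₁ f Z.1 Z.2‖ ≤ δ :=
    fun Z hZ _ => step idxAxis₁ idxAxis₁_snd idxNorm_idxAxis₁_le (sum_idxAxis₁_smul_slopeAt φ x₀) Z hZ
  have h₂ : ∀ Z ∈ idxBallF x₀ 1, Z + idxAxis₂ ∈ idxBallF x₀ 1 → ‖latDiff idxAxis₂ f Z.1 Z.2‖ ≤ δ :=
    fun Z hZ _ => step idxAxis₂ idxAxis₂_snd idxNorm_idxAxis₂_le (sum_idxAxis₂_smul_slopeAt φ x₀) Z hZ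
  have hXE : x₀ + E ∈ idxBallF x₀ 1 := by rw [mem_idxBallF_iff_idxNorm, add_sub_cancel_left]; exact hE1
  have hx₀ : x₀ ∈ idxBallF x₀ 1 := mem_idxBallF.mpr (by rw [dist_self]; norm_num)
  have hw := inPlane_walk f x₀ zero_le_one h₁ h₂ hXE hx₀ (by rw [Prod.snd_add, hE, add_zero])
  have hE1' : idxNorm E ≤ 1 := by exact_mod_cast hE1
  have a0 : ((((x₀ + E).1 - x₀.1) 0).natAbs : ℝ) ≤ 1 := by
    rw [Prod.fst_add, add_sub_cancel_left]
    exact_mod_cast (natAbs_fst_le_idxNorm E 0).trans hE1'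
  have a1 : ((((x₀ + E).1 - x₀.1) 1).natAbs : ℝ) ≤ 1 := by
    rw [Prod.fst_add, add_sub_cancel_left]
    exact_mod_cast (natAbs_fst_le_idxNorm E 1).trans hE1'
  have hv : f (x₀ + E).1 (x₀ + E).2 - f x₀.1 x₀.2 = latDiff E φ x₀.1 x₀.2 - ∑ j, ((E.1 j : ℤ) : ℝ) • slopeAt φ x₀ j := by
    rw [← key E hE x₀, latDiff_apply]
  rw [← hv]
  have hw' : ‖f (x₀ + E).1 (x₀ + E).2 - f x₀.1 x₀.2‖ ≤ 2 * δ := by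
    nlinarith [mul_le_mul_of_nonneg_right a0 hδ0, mul_le_mul_of_nonneg_right a1 hδ0]
  have hsq := pow_le_pow_left₀ (norm_nonneg _) hw' 2
  have hPA : P * δ ^ 2 = A := by
    rw [hδdef, Real.sq_sqrt (by positivity)]
    field_simp
  calc P * ‖f (x₀ + E).1 (x₀ + E).2 - f x₀.1 x₀.2‖ ^ 2 ≤ P * (2 * δ) ^ 2 := mul_le_mul_of_nonneg_left hsq hP0.le
    _ = 4 * (P * δ ^ 2) := by ring
    _ = 3456 * ipConst c κ₀ ε * idxEnergy φ (idxBall x₀ n) := by rw [hPA, hAdef]; ring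

/-- VERTICAL LEG: `D₃(φ − M)(Z)` = in-layer transport to the central column + profile comparison, with `n²N‖·‖² ≤ 3456·gradConst·dist(Z,x₀)²·E`
and `≤ C₀·(dist(Z,x₀) + 1)²·E`. [this file, g58] -/
theorem vertical_leg (hc : 0 < c) (hL : IsLayeredCrystal c a b w) {κ₀ ε ϱ : ℝ} (hκ₀ : 0 < κ₀) (hϱ : 0 ≤ ϱ) (hε : ε < 2 * κ₀)
    (hK : CoerciveZ (layeredKernel a b w) κ₀)
    (hT : ∀ φ : Cell 2 → ℤ → E3, HasFiniteSupport φ → Summable (tailFam ϱ a b w φ) ∧ ∑' x, tailFam ϱ a b w φ x ≤ ε * nnFormZ φ)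
    (hP : ∀ E₀ : Cell 2 × ℤ, E₀.2 = 0 → (idxNorm E₀ : ℝ) ≤ 1 → ∀ (y₀ : Cell 2 × ℤ) (r' n' : ℝ), r' < n' → ∀ χ : Cell 2 → ℤ → E3,
      IsTruncHarmonicZ ϱ a b w χ (idxBall y₀ (n' + 1)) →
        κ₀ * idxEnergy (latDiff E₀ χ) (idxBall y₀ r') ≤ 54 * kernelConst c * ((n' - r')⁻¹) ^ 2 * idxEnergy χ (idxBall y₀ (n' + ϱ / c + 1)))
    (x₀ : Cell 2 × ℤ) {n : ℝ} (hn : 512 * (ϱ / c + 2) ≤ n) {φ : Cell 2 → ℤ → E3} (hφ : IsTruncHarmonicZ ϱ a b w φ (idxBall x₀ n))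
    {cf : ℤ → E3} {C₀ : ℝ} (hC₀ : 0 ≤ C₀)
    (hpc : ∀ β : ℤ, |((β - x₀.2 : ℤ) : ℝ)| ≤ n / 2 →
      n ^ 2 * ((idxBall x₀ n).ncard : ℝ) * ‖latDiff idxAxis₃ φ x₀.1 β - (cf (β + 1) - cf β)‖ ^ 2 ≤
        C₀ * (|((β - x₀.2 : ℤ) : ℝ)| + 1) ^ 2 * idxEnergy φ (idxBall x₀ n))
    {Z : Cell 2 × ℤ} (hZ : Z ∈ idxBall x₀ (n / 2)) :
    ∃ u v : E3, latDiff idxAxis₃ (φ - modeField (slopeAt φ x₀) cf) Z.1 Z.2 = u + v ∧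
      n ^ 2 * ((idxBall x₀ n).ncard : ℝ) * ‖u‖ ^ 2 ≤ 3456 * gradConst c κ₀ ε * dist Z x₀ ^ 2 * idxEnergy φ (idxBall x₀ n) ∧
      n ^ 2 * ((idxBall x₀ n).ncard : ℝ) * ‖v‖ ^ 2 ≤ C₀ * (dist Z x₀ + 1) ^ 2 * idxEnergy φ (idxBall x₀ n) := by
  have hE0 := idxEnergy_nonneg φ (idxBall x₀ n)
  have dZ : dist Z x₀ ≤ n / 2 := hZ
  have hβ : |((Z.2 - x₀.2 : ℤ) : ℝ)| ≤ dist Z x₀ := by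
    have h1 : (((Z.2 - x₀.2).natAbs : ℕ) : ℝ) ≤ idxNorm (Z - x₀) := by exact_mod_cast natAbs_snd_le_idxNorm (Z - x₀)
    rw [Nat.cast_natAbs, Int.cast_abs] at h1
    rwa [dist_comm, dist_eq_idxNorm]
  have h4 := hpc Z.2 (hβ.trans dZ)
  refine ⟨latDiff idxAxis₃ φ Z.1 Z.2 - latDiff idxAxis₃ φ x₀.1 Z.2, latDiff idxAxis₃ φ x₀.1 Z.2 - (cf (Z.2 + 1) - cf Z.2), ?_,
    vertical_bond_inPlane_halfBall hc hL hκ₀ hϱ hε hK hT hP x₀ hn hφ hZ, ?_⟩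
  · simp only [latDiff_sub, Pi.sub_apply, latDiff_modeField_axis₃]
    abel
  · have hb : (|((Z.2 - x₀.2 : ℤ) : ℝ)| + 1) ^ 2 ≤ (dist Z x₀ + 1) ^ 2 := pow_le_pow_left₀ (by positivity) (by linarith) 2
    exact h4.trans (mul_le_mul_of_nonneg_right (mul_le_mul_of_nonneg_left hb hC₀) hE0)

/-! ### WN.4  ★★ The assembly -/

/-- four summands: `P·s² ≤ 4·ΣAᵢ` from `s ≤ Σaᵢ` and `P·aᵢ² ≤ Aᵢ`. [formal bookkeeping] -/
theorem four_sq_bound {P s a₁ a₂ a₃ a₄ A₁ A₂ A₃ A₄ : ℝ} (hP : 0 ≤ P) (hs : s ≤ a₁ + a₂ + a₃ + a₄) (hs0 : 0 ≤ s)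
    (h₁ : P * a₁ ^ 2 ≤ A₁) (h₂ : P * a₂ ^ 2 ≤ A₂) (h₃ : P * a₃ ^ 2 ≤ A₃) (h₄ : P * a₄ ^ 2 ≤ A₄) :
    P * s ^ 2 ≤ 4 * (A₁ + A₂ + A₃ + A₄) := by
  have e1 : s ^ 2 ≤ (a₁ + a₂ + a₃ + a₄) ^ 2 := pow_le_pow_left₀ hs0 hs 2
  have e2 : (a₁ + a₂ + a₃ + a₄) ^ 2 ≤ 4 * (a₁ ^ 2 + a₂ ^ 2 + a₃ ^ 2 + a₄ ^ 2) := by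
    nlinarith [sq_nonneg (a₁ - a₂), sq_nonneg (a₁ - a₃), sq_nonneg (a₁ - a₄), sq_nonneg (a₂ - a₃), sq_nonneg (a₂ - a₄),
      sq_nonneg (a₃ - a₄)]
  have e3 := mul_le_mul_of_nonneg_left (e1.trans e2) hP
  linarith

/-- collecting the four bond constants into `16·(4320·ip + 3456·gc + C₀)·(d+1)²·E`. [formal bookkeeping] -/
theorem bond_constants {ip gc C₀ d E P s : ℝ} (hip : 0 ≤ ip) (hgc : 0 ≤ gc) (hC₀ : 0 ≤ C₀) (hd : 0 ≤ d) (hE : 0 ≤ E)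
    (h : P * s ^ 2 ≤ 4 * (864 * ip * d ^ 2 * E + 3456 * ip * E + 3456 * gc * (d + 1) ^ 2 * E + C₀ * (d + 2) ^ 2 * E)) :
    P * s ^ 2 ≤ 16 * (4320 * ip + 3456 * gc + C₀) * (d + 1) ^ 2 * E := by
  have e1 : d ^ 2 ≤ (d + 1) ^ 2 := by nlinarith
  have e2 : (1 : ℝ) ≤ (d + 1) ^ 2 := by nlinarith
  have e3 : (d + 2) ^ 2 ≤ 4 * (d + 1) ^ 2 := by nlinarith
  have k1 := mul_le_mul_of_nonneg_left e1 (mul_nonneg hip hE)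
  have k2 := mul_le_mul_of_nonneg_left e2 (mul_nonneg hip hE)
  have k3 := mul_le_mul_of_nonneg_left e3 (mul_nonneg hC₀ hE)
  have k4 : 0 ≤ gc * E * (d + 1) ^ 2 := by positivity
  have k5 : 0 ≤ ip * E * (d + 1) ^ 2 := by positivity
  have k6 : 0 ≤ C₀ * E * (d + 1) ^ 2 := by positivity
  linarith

/-- ★★ THE MODULUS BRICK (4a) FROM THE PROFILE COMPARISON: under the standing hypotheses (layered crystal, coercivity, tail smallness `hT`,
Caccioppoli `hP`), `ProfileComparisonAt C₀ ϱ n₀ a b w` implies `ModalLipschitzAt (16·(4320·ipConst + 3456·gradConst + C₀)) ϱ (max n₀ (512(ϱ/c+2)))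
a b w`, with the mode `modeField (slopeAt φ x₀) cf` of (PC); the constant is `ϱ`-FREE when `C₀` is. [this file, g58] -/
theorem modalLipschitzAt_of_profileComparison (hc : 0 < c) (hL : IsLayeredCrystal c a b w) {κ₀ ε ϱ : ℝ} (hκ₀ : 0 < κ₀) (hϱ : 0 ≤ ϱ)
    (hε : ε < 2 * κ₀) (hK : CoerciveZ (layeredKernel a b w) κ₀)
    (hT : ∀ φ : Cell 2 → ℤ → E3, HasFiniteSupport φ → Summable (tailFam ϱ a b w φ) ∧ ∑' x, tailFam ϱ a b w φ x ≤ ε * nnFormZ φ)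
    (hP : ∀ E₀ : Cell 2 × ℤ, E₀.2 = 0 → (idxNorm E₀ : ℝ) ≤ 1 → ∀ (y₀ : Cell 2 × ℤ) (r' n' : ℝ), r' < n' → ∀ χ : Cell 2 → ℤ → E3,
      IsTruncHarmonicZ ϱ a b w χ (idxBall y₀ (n' + 1)) →
        κ₀ * idxEnergy (latDiff E₀ χ) (idxBall y₀ r') ≤ 54 * kernelConst c * ((n' - r')⁻¹) ^ 2 * idxEnergy χ (idxBall y₀ (n' + ϱ / c + 1)))
    {C₀ n₀ : ℝ} (hC₀ : 0 ≤ C₀) (hPC : ProfileComparisonAt C₀ ϱ n₀ a b w) :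
    ModalLipschitzAt (16 * (4320 * ipConst c κ₀ ε + 3456 * gradConst c κ₀ ε + C₀)) ϱ (max n₀ (512 * (ϱ / c + 2))) a b w := by
  intro φ x₀ n hn hφ
  have hn₀ : n₀ ≤ n := (le_max_left _ _).trans hn
  have hn' : 512 * (ϱ / c + 2) ≤ n := (le_max_right _ _).trans hn
  have hϱc : 0 ≤ ϱ / c := div_nonneg hϱ hc.le
  have hn0 : 0 < n := by linarith
  have hN := ncard_idxBall_pos x₀ hn0.le
  have hip := ipConst_nonneg hc hκ₀ ε
  have hgc := gradConst_nonneg hc hκ₀ ε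
  have hE0 := idxEnergy_nonneg φ (idxBall x₀ n)
  obtain ⟨cf, hMode, hpc⟩ := hPC φ x₀ n hn₀ hφ
  refine ⟨modeField (slopeAt φ x₀) cf, hMode, fun X Y hX hY hXY => ?_⟩
  set f := φ - modeField (slopeAt φ x₀) cf with hfdef
  have dX0 : 0 ≤ dist X x₀ := dist_nonneg
  obtain ⟨_, _, hE1, hXE, Z, hZ, hdZ, hv⟩ := unitBond_split f hX hY hXY
  obtain ⟨u₁, u₂, e12, s₁, s₂⟩ :=
    inPlane_leg hc hL hκ₀ hϱ hε hK hT hP x₀ hn' hφ cf (rfl : ((Y.1 - X.1, 0) : Cell 2 × ℤ).2 = 0) hE1 hX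
  obtain ⟨u₃, u₄, e34, s₃, s₄⟩ := vertical_leg hc hL hκ₀ hϱ hε hK hT hP x₀ hn' hφ hC₀ hpc hZ
  have hleg₁ : f Y.1 X.2 - f X.1 X.2 = u₁ + u₂ := by
    rw [← e12, latDiff_apply, hXE]
  have key : ‖f Y.1 Y.2 - f X.1 X.2‖ ≤ ‖u₁‖ + ‖u₂‖ + ‖u₃‖ + ‖u₄‖ := by
    have h1 : f Y.1 Y.2 - f X.1 X.2 = (f Y.1 Y.2 - f Y.1 X.2) + (u₁ + u₂) := by rw [← hleg₁]; abel
    rw [h1]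
    have h2 : ‖f Y.1 Y.2 - f Y.1 X.2‖ ≤ ‖u₃‖ + ‖u₄‖ := hv.trans (by rw [e34]; exact norm_add_le _ _)
    linarith [norm_add_le (f Y.1 Y.2 - f Y.1 X.2) (u₁ + u₂), norm_add_le u₁ u₂]
  have s₃' : n ^ 2 * ((idxBall x₀ n).ncard : ℝ) * ‖u₃‖ ^ 2 ≤ 3456 * gradConst c κ₀ ε * (dist X x₀ + 1) ^ 2 * idxEnergy φ (idxBall x₀ n) :=
    s₃.trans (mul_le_mul_of_nonneg_right (mul_le_mul_of_nonneg_left (pow_le_pow_left₀ dist_nonneg hdZ 2) (by positivity)) hE0)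
  have s₄' : n ^ 2 * ((idxBall x₀ n).ncard : ℝ) * ‖u₄‖ ^ 2 ≤ C₀ * (dist X x₀ + 2) ^ 2 * idxEnergy φ (idxBall x₀ n) :=
    s₄.trans (mul_le_mul_of_nonneg_right (mul_le_mul_of_nonneg_left
      (pow_le_pow_left₀ (by positivity) (by linarith : dist Z x₀ + 1 ≤ dist X x₀ + 2) 2) hC₀) hE0)
  have h4 := four_sq_bound (by positivity) key (norm_nonneg _) s₁ s₂ s₃' s₄'
  exact bond_constants hip hgc hC₀ dX0 hE0 h4

/-! ### WN.5  The closed statement of this part -/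

/-- The content of part WN as one closed proposition: the modulus brick (4a) follows from the profile comparison (PC) on the central column. -/
def ModalAssemblyShape : Prop :=
  ∀ c : ℝ, 0 < c → ∀ (a b : E3) (w : ℤ → E3), IsLayeredCrystal c a b w → ∀ κ₀ ε ϱ : ℝ, 0 < κ₀ → 0 ≤ ϱ → ε < 2 * κ₀ →
    CoerciveZ (layeredKernel a b w) κ₀ →
    (∀ φ : Cell 2 → ℤ → E3, HasFiniteSupport φ → Summable (tailFam ϱ a b w φ) ∧ ∑' x, tailFam ϱ a b w φ x ≤ ε * nnFormZ φ) →
    (∀ E₀ : Cell 2 × ℤ, E₀.2 = 0 → (idxNorm E₀ : ℝ) ≤ 1 → ∀ (y₀ : Cell 2 × ℤ) (r' n' : ℝ), r' < n' → ∀ χ : Cell 2 → ℤ → E3,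
      IsTruncHarmonicZ ϱ a b w χ (idxBall y₀ (n' + 1)) →
        κ₀ * idxEnergy (latDiff E₀ χ) (idxBall y₀ r') ≤ 54 * kernelConst c * ((n' - r')⁻¹) ^ 2 * idxEnergy χ (idxBall y₀ (n' + ϱ / c + 1))) →
    ∀ C₀ n₀ : ℝ, 0 ≤ C₀ → ProfileComparisonAt C₀ ϱ n₀ a b w →
      ModalLipschitzAt (16 * (4320 * ipConst c κ₀ ε + 3456 * gradConst c κ₀ ε + C₀)) ϱ (max n₀ (512 * (ϱ / c + 2))) a b w

/-- WN holds. [this file, g58] -/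
theorem modalAssemblyShape_holds : ModalAssemblyShape :=
  fun _c hc _a _b _w hL _κ₀ _ε _ϱ hκ₀ hϱ hε hK hT hP _C₀ _n₀ hC₀ hPC =>
    modalLipschitzAt_of_profileComparison hc hL hκ₀ hϱ hε hK hT hP hC₀ hPC

end ModalAssembly

end Summit.AtomisticToContinuum.Crystallization.Theorems.ChartedZeroExcessLayeredLatticeLiouville
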